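import Mathlib
import Summits.Ventures.HodgeRepro2.Tier7.Line1.SepCenter
import Summits.Ventures.HodgeRepro2.T6InterfaceK7
import Summits.Ventures.HodgeRepro2.T6A1EigenGen

/-!
# Tier7/Line1/SepArith — the arithmetic part of the separating datum

The SEPARATING DATUM of t7-L1-p2 (LINE L1, residual probe). The fields, the hermitian space, the face, the
embedding `s` and the eigenvectors `e i` are those of the DATUM OF RECORD of t7-crit-1
(`review/OBJECTION-Target-t7-crit-1.JunkModel-frozen.lean` ll. 276–347 and 476–496, reproduced here with
attribution): `K7 = ℚ(ζ₇)` with its complex conjugation, the standard hermitian form on `K7³`, the parity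
tetrahedron of `CyclotomicSeven.exists_isWeilFace_K7`, `sJ = τ 0`, `eJ i = eGen K7 (s_i) i`. New here: the
antilinear involution `barM` of `H1C K7` as a `JBar` (the junk of the datum), the eigen-basis `bH` of `H1C K7` built
from `A1EigenGen.vGen` and its coordinate functionals `coordE i` with `coordE i (eJ j) = δ_{ij}`.
Author: t7-L1-p2 (prover-pub-hodge-repro2-t7-L1-p2-g0-0). §8(d): NO.
-/

namespace Summit.Ventures.HodgeRepro2.Tier7.Line1.Sep

open Summit.Ventures.HodgeRepro2 Summit.Ventures.HodgeRepro2.T6 Summit.Ventures.HodgeRepro2.Tier7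
open scoped TensorProduct

noncomputable section

/-! ## The field `K7 = ℚ(ζ₇)` (datum of record, crit-1) -/

/-- `K7 = ℚ(ζ₇)` -/
abbrev K7 := CyclotomicSeven.K7

/-- `K7` is a CM field -/
instance instIsCMFieldK7 : NumberField.IsCMField K7 := CyclotomicSeven.isCMField_K7

/-- complex conjugation of `K7` as a ring hom -/
def conjK7 : K7 →+* K7 := RingHomClass.toRingHom (NumberField.IsCMField.complexConj K7)

/-- `conjK7` unfolded -/
theorem conjK7_apply (x : K7) : conjK7 x = NumberField.IsCMField.complexConj K7 x := rfl

/-- `conjK7` is complex conjugation under every embedding -/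
theorem conjK7_embed (σ : K7 →+* ℂ) (x : K7) : σ (conjK7 x) = (starRingEnd ℂ) (σ x) := by
  rw [conjK7_apply]
  exact NumberField.IsCMField.complexEmbedding_complexConj K7 σ x

/-- `conjK7` is an involution -/
theorem conjK7_conjK7 (x : K7) : conjK7 (conjK7 x) = x := by
  rw [conjK7_apply, conjK7_apply]
  exact NumberField.IsCMField.complexConj_apply_apply K7 x

/-- `K7` has an embedding -/
theorem nonempty_emb : Nonempty (K7 →+* ℂ) := by
  have h := NumberField.Embeddings.card K7 ℂ
  rw [CyclotomicSeven.finrank_K7] at h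
  exact Fintype.card_pos_iff.1 (by omega)

/-- `conjK7` is not the identity -/
theorem conjK7_ne : ∃ x : K7, conjK7 x ≠ x := by
  by_contra h
  push Not at h
  obtain ⟨φ⟩ := nonempty_emb
  have hreal : NumberField.ComplexEmbedding.IsReal φ := by
    rw [NumberField.ComplexEmbedding.isReal_iff]
    ext x
    rw [NumberField.ComplexEmbedding.conjugate_coe_eq, ← conjK7_embed, h x]
  have hc : (NumberField.InfinitePlace.mk φ).IsComplex :=
    NumberField.IsTotallyComplex.isComplex (NumberField.InfinitePlace.mk φ)
  exact (NumberField.InfinitePlace.isComplex_mk_iff.1 hc) hreal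

/-- the CM field data `K7 ⊆ K7` -/
def cmK7 : CMFieldOver K7 K7 where
  galK := CyclotomicSeven.isGalois_K7
  conjK := conjK7
  conjK_embed := conjK7_embed
  incl := RingHom.id K7
  galois := CyclotomicSeven.isGalois_K7
  conj := conjK7
  conj_conj := conjK7_conjK7
  conj_embed := conjK7_embed
  conj_ne := conjK7_ne
  conj_incl := fun _ => rfl
  plus_deg := by rw [CyclotomicSeven.finrank_K7]; norm_num

/-- the standard hermitian form on `K7³` -/
def hStd (v w : Fin 3 → K7) : K7 := ∑ i, v i * conjK7 (w i)

/-- `hStd` is anisotropic -/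
theorem hStd_aniso (v : Fin 3 → K7) (hv : hStd v v = 0) : v = 0 := by
  obtain ⟨φ⟩ := nonempty_emb
  have h1 : φ (hStd v v) = 0 := by rw [hv, map_zero]
  have h2 : φ (hStd v v) = ((∑ i, Complex.normSq (φ (v i)) : ℝ) : ℂ) := by
    simp only [hStd, map_sum, map_mul, conjK7_embed, Complex.mul_conj, Complex.ofReal_sum]
  rw [h2] at h1
  have h3 : (∑ i, Complex.normSq (φ (v i)) : ℝ) = 0 := by exact_mod_cast h1
  rw [Finset.sum_eq_zero_iff_of_nonneg (fun i _ => Complex.normSq_nonneg _)] at h3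
  funext i
  have := Complex.normSq_eq_zero.1 (h3 i (Finset.mem_univ i))
  exact φ.injective (by rw [this, Pi.zero_apply, map_zero])

/-- the hermitian 3-space of the datum -/
def hermK7 : HermitianSpace3 cmK7 (Fin 3 → K7) where
  dim3 := Module.finrank_fin_fun K7
  h := hStd
  h_add := by intro u v w; simp [hStd, add_mul, Finset.sum_add_distrib]
  h_smul := by intro a v w; simp [hStd, Finset.mul_sum, mul_assoc]
  h_herm := by
    intro v w
    simp only [hStd, cmK7, map_sum, map_mul, conjK7_conjK7]
    refine Finset.sum_congr rfl fun i _ => mul_comm _ _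
  h_aniso := hStd_aniso

/-! ## The face, the embedding, the eigenvectors (datum of record, crit-1) -/

/-- the parity tetrahedron of `ℚ(ζ₇)` -/
def tau : Fin 3 → K7 →+* ℂ := Classical.choose CyclotomicSeven.exists_isWeilFace_K7

/-- the face -/
def faceJ : Face K7 where
  T := parityTetrahedron K7 tau
  face := Classical.choose_spec CyclotomicSeven.exists_isWeilFace_K7

/-- the embedding `s` -/
def sJ : K7 →+* ℂ := tau 0

/-- `s̄` -/
theorem sbar_eq : (starRingEnd ℂ).comp sJ = NumberField.ComplexEmbedding.conjugate sJ := by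
  ext x
  simp [NumberField.ComplexEmbedding.conjugate_coe_eq]

/-- `s ∈ T 0` -/
theorem sJ_mem0 : sJ ∈ faceJ.T 0 := ⟨0, by simp [sJ]⟩
/-- `s ∈ T 1` -/
theorem sJ_mem1 : sJ ∈ faceJ.T 1 := ⟨0, by simp [sJ]⟩
/-- `s̄ ∈ T 2` -/
theorem sbar_mem2 : (starRingEnd ℂ).comp sJ ∈ faceJ.T 2 := ⟨0, by rw [sbar_eq]; simp [sJ]⟩
/-- `s̄ ∈ T 3` -/
theorem sbar_mem3 : (starRingEnd ℂ).comp sJ ∈ faceJ.T 3 := ⟨0, by rw [sbar_eq]; simp [sJ]⟩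

/-- the embeddings `s, s, s̄, s̄` of the four corners -/
def sIdx : Fin 4 → (K7 →+* ℂ) := ![sJ, sJ, (starRingEnd ℂ).comp sJ, (starRingEnd ℂ).comp sJ]

/-- the eigenvectors `e i = eGen K7 (s_i) i` -/
def eJ : Fin 4 → H1C K7 := fun i => A1EigenGen.eGen K7 (sIdx i) i

/-- `eJ` unfolded -/
theorem eJ_apply (i : Fin 4) : eJ i = Pi.single i (A1EigenGen.vGen K7 (sIdx i)) := by
  simp [eJ, A1EigenGen.eGen, LinearMap.single_apply]

/-! ## Conjugation on `H¹(B, ℂ)` (datum of record, crit-1) -/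

/-- conjugation on `ℂ ⊗ K7` (conj ⊗ id) -/
def barK : KC K7 →ₐ[ℚ] KC K7 :=
  Algebra.TensorProduct.map (starRingEnd ℂ).toRatAlgHom (AlgHom.id ℚ K7)

/-- `barK` on a pure tensor -/
theorem barK_tmul (c : ℂ) (k : K7) : barK (c ⊗ₜ[ℚ] k) = (starRingEnd ℂ c) ⊗ₜ[ℚ] k := by
  simp [barK, Algebra.TensorProduct.map_tmul]

/-- `barK` is antilinear -/
theorem barK_smul (z : ℂ) (w : KC K7) : barK (z • w) = (starRingEnd ℂ z) • barK w := by
  induction w using TensorProduct.induction_on with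
  | zero => simp
  | tmul c k =>
    rw [TensorProduct.smul_tmul', barK_tmul, barK_tmul, TensorProduct.smul_tmul', smul_eq_mul, smul_eq_mul,
      map_mul]
  | add u v hu hv => rw [smul_add, map_add, hu, hv, map_add, smul_add]

/-- `barK` is an involution -/
theorem barK_barK (w : KC K7) : barK (barK w) = w := by
  induction w using TensorProduct.induction_on with
  | zero => simp
  | tmul c k => rw [barK_tmul, barK_tmul, Complex.conj_conj]
  | add u v hu hv => rw [map_add, map_add, hu, hv]

/-- conjugation on `H¹(B, ℂ)` componentwise -/
def barM (v : H1C K7) : H1C K7 := fun i => barK (v i)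

/-- `barM` is additive -/
theorem barM_add (v w : H1C K7) : barM (v + w) = barM v + barM w := by
  funext i; simp [barM, map_add]

/-- `barM` is antilinear -/
theorem barM_smul (z : ℂ) (v : H1C K7) : barM (z • v) = (starRingEnd ℂ z) • barM v := by
  funext i; simp [barM, barK_smul]

/-- `barM` is an involution -/
theorem barM_barM (v : H1C K7) : barM (barM v) = v := by
  funext i; simp [barM, barK_barK]

/-- the junk conjugation of the datum -/
def jbK : JBar (H1C K7) where
  b := barM
  b_add := barM_add
  b_smul := barM_smul
  b_b := barM_barM

/-! ## The eigen-basis of `H¹(B, ℂ)` and its coordinates -/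

/-- `Fintype.card (K7 →+* ℂ) = finrank ℂ (KC K7)` -/
theorem card_emb_eq_finrank : Fintype.card (K7 →+* ℂ) = Module.finrank ℂ (KC K7) := by
  rw [NumberField.Embeddings.card K7 ℂ]
  exact (Module.finrank_baseChange (R := ℂ) (S := ℚ) (M' := K7)).symm

/-- the eigen-basis `vGen σ` of `KC K7` -/
def bK : Module.Basis (K7 →+* ℂ) ℂ (KC K7) :=
  basisOfTopLeSpanOfCardEqFinrank (A1EigenGen.vGen K7) (by rw [A1EigenGen.span_range_vGen]) card_emb_eq_finrank

/-- `bK σ = vGen σ` -/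
theorem bK_apply (σ : K7 →+* ℂ) : bK σ = A1EigenGen.vGen K7 σ := by
  simp [bK]

/-- the eigen-basis of `H1C K7 = Fin 4 → KC K7` -/
def bH : Module.Basis ((_ : Fin 4) × (K7 →+* ℂ)) ℂ (H1C K7) := Pi.basis fun _ => bK

/-- `eJ i` is a basis vector -/
theorem eJ_eq_bH (i : Fin 4) : eJ i = bH ⟨i, sIdx i⟩ := by
  rw [eJ_apply, bH, Pi.basis_apply, bK_apply]

/-- the coordinate functional along `eJ i` -/
def coordE (i : Fin 4) : H1C K7 →ₗ[ℂ] ℂ := bH.coord ⟨i, sIdx i⟩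

/-- `coordE i (eJ j) = δ_{ij}` -/
theorem coordE_eJ (i j : Fin 4) : coordE i (eJ j) = if i = j then 1 else 0 := by
  classical
  rw [coordE, eJ_eq_bH, Module.Basis.coord_apply, Module.Basis.repr_self, Finsupp.single_apply]
  by_cases h : i = j
  · subst h; simp
  · have : (⟨j, sIdx j⟩ : (_ : Fin 4) × (K7 →+* ℂ)) ≠ ⟨i, sIdx i⟩ := fun e => h (Sigma.mk.inj_iff.1 e).1.symm
    rw [if_neg this, if_neg h]

end

end Summit.Ventures.HodgeRepro2.Tier7.Line1.Sep
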